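import Literature.AlgebraicGeometry.RelativeSpec.DescentOfUnitCharacterCount
import Literature.AlgebraicGeometry.AbelianSchemes.PoincarePullbackCharOfCount
import Literature.AlgebraicGeometry.AbelianSchemes.AbelianSchemeDualPairSlice
import Literature.AlgebraicGeometry.AbelianSchemes.AbelianSchemeSteinOfReduced
import Literature.AlgebraicGeometry.Motives.AbelianVarietyIsogenyGeometricQuotient
import Literature.AlgebraicGeometry.RelativeSpec.GeometricQuotientFreeFlat
import Literature.AlgebraicGeometry.Modules.RankOneDescentAlongH0Iso
import HarnessLib

/-!
# `#{b ∈ Â_t(ℂ) : π_t^*𝒫_b ≅ 𝒪_{X_t}} ≤ #ker π_t(ℂ)` at a complex point — the injectivity half of [MumfordAV1970] §15 Thm. 1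

Layer `Literature/AlgebraicGeometry/AbelianSchemes`, namespace `Literature.AlgebraicGeometry.AbelianSchemes.AbelianSchemeOver.DualPair`.
THEOREMS ONLY (no definition, no named fact, no instance, no `sorry`).  Same currency as ★ `PoincarePullbackTorsion` / ★
`PoincarePullbackCharOfCount`: `A/S` an abelian scheme (`S : Scheme.{0}`), `D = (Â, 𝒫)` a dual pair, `X/S` an abelian scheme with a
homomorphism `π : X → A`, `N := (π × 1_Â)^*𝒫` on `X ×_S Â`; a complex point `t : Spec ℂ → S` at which `π_t : X_t → A_t` is an
ISOGENY.

[MumfordAV1970] §15 Thm. 1: «if `f : X → Y` is an isogeny with kernel `K`, the dual map `f̂ : Ŷ → X̂` is an isogeny whose kernel is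
the Cartier dual of `K`»; in particular the set `T_t := {b ∈ Â_t(ℂ) | (1_X × b)^*N = π_t^*𝒫_b ≅ 𝒪}` (the kernel of `π̂_t` on
complex points) has AT MOST `#ker π_t(ℂ)` elements.  PROOF (descent along the free quotient, [MumfordAV1970] §12 Thm. 1 / §7
Thm. 4): `π_t` is an affine flat geometric quotient of `X_t` by the free action of its finite kernel through translations (★
`Motives.AbelianVariety.isGeometricQuotient_kerTranslationActionOver`, `kerTranslationActionOver_free`, `isAffineHom_of_isIsogeny`, ★
`GeometricQuotientFreeFlat.flat_of_free`); the modules `𝒫_b`, `b ∈ T_t`, on `A_t` have trivial pull-backs (★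
`nonempty_pullback_baseChangeToProd_whiskerRight_iso`) and are pairwise non-isomorphic (uniqueness in the universal property of the
dual pair, ★ `DualPair.eq_of_nonempty_iso` against the 𝒫-slice ★ `sliceBundle`); the kernel translations fix `Γ(X_t, 𝒪) = ℂ`
(Stein, ★ `appTop_bijective_of_isReduced`) and `Γ(X_t, 𝒪)` is a domain (`X_t` is integral); so ★
`ActionOver.finite_and_natCard_le_card_of_forall_iso` (eigenvalue characters + Dedekind independence) bounds `#T_t` by the order
of the kernel.

* `toSchemeHom_fibreHom_eq` — `(π_t)` as a scheme morphism is the base change `(baseChangeHom π t).left` (`rfl`);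
* **`finite_and_ncard_le_natCard_kerPoints`** — `T_t` is finite with `#T_t ≤ #ker π_t(ℂ)`, stated VERBATIM in the `hcard` currency of
  ★ `PoincarePullbackCharOfCount.section_mem_of_spread_of_ncard_le` (`Ω₀ := ℂ`).

Cell `hodgecm-mathlib` (D-0151), HECKE-LINK socket (B), brick (K5c-1) (B-p02 (g11); road (R-dual) at a complex point, B-p20 (g9) 23:15Z /
B-p09 (g10) 23:11Z): with the counts `#ker π_t(ℂ) = n^{2g}/#K₀` (I2) and `#{c | φ̂(c) ∈ K′} = #K₀^⊥` (I3, ★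
`natCard_annihilator_mul_natCard_sum`) this is the `hcardℂ` input of `hChar`.  Count-neutral.  HC_CM is proved only modulo the 7
printed citations until rung 0 closes.

## References
* [MumfordAV1970] D. Mumford, *Abelian Varieties* (1970), §7 Thm. 4 (p. 72), §12 Thm. 1 (p. 112), §15 Thm. 1 (p. 143).
* [MilneAV2008] J. S. Milne, *Abelian Varieties* (v2.00, 2008), I §8 pp. 36–37 (uniqueness in the universal property of the dual).
* [GortzWedhorn2020] U. Görtz, T. Wedhorn, *Algebraic Geometry I* (2nd ed., 2020), Section (4.7) (pp. 107–108).
-/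

set_option autoImplicit false

noncomputable section

-- `Scheme.Modules` / `SheafOfModules` are not reducible (as in Mathlib's `AlgebraicGeometry/Modules/Sheaf.lean`).
set_option backward.isDefEq.respectTransparency false

open CategoryTheory CategoryTheory.Limits AlgebraicGeometry MonoidalCategory CartesianMonoidalCategory TopologicalSpace Opposite
open scoped MonObj

namespace Literature.AlgebraicGeometry.AbelianSchemes

namespace AbelianSchemeOver

open Literature.AlgebraicGeometry.Motives Literature.AlgebraicGeometry.AbelianVarieties Literature.AlgebraicGeometry.Modules
  Literature.AlgebraicGeometry.RelativeSpec

namespace DualPair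

variable {S : Scheme.{0}} {X A : AbelianSchemeOver S} (D : A.DualPair) (π : X.X ⟶ A.X) [IsMonHom π]

/-- The underlying scheme morphism of `π_t` is the base change `(π_t).left` (by construction). [cite: GortzWedhorn2020, Section (4.7) (pp. 107–108)] -/
theorem toSchemeHom_fibreHom_eq (t : Spec (.of ℂ) ⟶ S) :
    AbelianVariety.Hom.toSchemeHom (fibreHom π t) = (baseChangeHom π t).left := rfl

/-- **`#{b ∈ Â_t(ℂ) : (1_X × b)^*N ≅ 𝒪} ≤ #ker π_t(ℂ)` at a complex point** (`N = (π × 1_Â)^*𝒫`), for `π_t` an isogeny — the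
injectivity half of [MumfordAV1970] §15 Thm. 1 («`ker π̂ = (ker π)^D`») in the `FibrePoints` currency of ★
`PoincarePullbackCharOfCount` (the `hcard` input of ★ `section_mem_of_spread_of_ncard_le` at `Ω₀ = ℂ`): `π_t : X_t → A_t` is a free
affine flat geometric quotient by its kernel translations (★ `isGeometricQuotient_kerTranslationActionOver`, ★
`kerTranslationActionOver_free`), the bundles `𝒫_b`, `b ∈ T_t`, are pairwise non-isomorphic modules on `A_t` (★ point-injectivity
of the dual pair, `eq_of_nonempty_iso` against the 𝒫-slice) trivialised on `X_t`, the kernel translations fix `Γ(X_t, 𝒪) = ℂ`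
(Stein, ★ `appTop_bijective_of_isReduced`), so ★ `finite_and_natCard_le_card_of_forall_iso` applies.
[cite: MumfordAV1970, §15 Thm. 1 (p. 143) and §12 Thm. 1 (p. 112)] [cite: MilneAV2008, I §8 pp. 36–37] -/
theorem finite_and_ncard_le_natCard_kerPoints (t : Spec (.of ℂ) ⟶ S) (hπ : AbelianVariety.IsIsogeny (fibreHom π t)) :
    {b : D.hat.FibrePoints t | Nonempty ((Scheme.Modules.pullback (X.baseChangeToProd D.hat t b.left (Over.w b))).obj
        ((Scheme.Modules.pullback (π ▷ D.hat.X).left).obj D.P) ≅ SheafOfModules.unit _)}.Finite ∧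
    {b : D.hat.FibrePoints t | Nonempty ((Scheme.Modules.pullback (X.baseChangeToProd D.hat t b.left (Over.w b))).obj
        ((Scheme.Modules.pullback (π ▷ D.hat.X).left).obj D.P) ≅ SheafOfModules.unit _)}.ncard ≤
      Nat.card (AbelianVariety.Hom.kerPoints (specOver ℂ ℂ) (fibreHom π t)) := by
  classical
  set T : Set (D.hat.FibrePoints t) := {b : D.hat.FibrePoints t | Nonempty ((Scheme.Modules.pullback
      (X.baseChangeToProd D.hat t b.left (Over.w b))).obj
        ((Scheme.Modules.pullback (π ▷ D.hat.X).left).obj D.P) ≅ SheafOfModules.unit _)} with hT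
  -- the isogeny `π_t` as a free affine flat geometric quotient by its kernel translations (★ p697566)
  set f := fibreHom π t with hf
  haveI : IsFinite (AbelianVariety.Hom.toSchemeHom f) := hπ.2
  haveI : Finite (AbelianVariety.Hom.kerPoints (specOver ℂ ℂ) f) := AbelianVariety.finite_kerPoints_of_isFinite f ℂ
  letI : Fintype (AbelianVariety.Hom.kerPoints (specOver ℂ ℂ) f) := Fintype.ofFinite _
  haveI := AbelianVariety.isAffineHom_of_isIsogeny f hπ
  have hq := AbelianVariety.isGeometricQuotient_kerTranslationActionOver f hπ
  have hfree := AbelianVariety.kerTranslationActionOver_free f hπ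
  haveI : Flat (AbelianVariety.Hom.toSchemeHom f) := hq.flat_of_free hfree
  -- the family of bundles `𝒫_b`, `b ∈ T`, on `A_t`, trivialised on `X_t`
  let M : T → (pullback A.X.hom t).Modules := fun b => D.pullbackP t b.1.left (Over.w b.1)
  haveI : ∀ b, ((Scheme.Modules.pullback (AbelianVariety.Hom.toSchemeHom f)).obj (M b)).IsQuasicoherent := fun b =>
    isQuasicoherent_of_hasRank (hasRank_pullback _ (hasRank_pullback _ D.hasRank_one))
  haveI : IsIso (C := (pullback X.X.hom t).Modules)
      (SheafOfModules.pullbackObjUnitToUnit (AbelianVariety.Hom.toSchemeHom f).toRingCatSheafHom) := by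
    haveI := Literature.AlgebraicGeometry.KTheory.final_opensMap (AbelianVariety.Hom.toSchemeHom f)
    exact SheafOfModules.instIsIsoPullbackObjUnitToUnitOfFinal _
  have htriv : ∀ b : T, Nonempty ((Scheme.Modules.pullback (AbelianVariety.Hom.toSchemeHom f)).obj (M b) ≅
      SheafOfModules.unit _) := fun b => by
    obtain ⟨j⟩ := b.2
    obtain ⟨e₁⟩ := D.nonempty_pullback_baseChangeToProd_whiskerRight_iso (X := X) π t b.1.left (Over.w b.1)
    exact ⟨e₁.symm ≪≫ j⟩
  let e : ∀ b : T, (Scheme.Modules.pullback (AbelianVariety.Hom.toSchemeHom f)).obj (SheafOfModules.unit _) ≅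
      (Scheme.Modules.pullback (AbelianVariety.Hom.toSchemeHom f)).obj (M b) := fun b =>
    asIso (C := (pullback X.X.hom t).Modules)
      (SheafOfModules.pullbackObjUnitToUnit (AbelianVariety.Hom.toSchemeHom f).toRingCatSheafHom) ≪≫ (htriv b).some.symm
  -- pairwise non-isomorphic: `𝒫_b ≅ 𝒫_{b′} ⟹ b = b′` (uniqueness in the universal property of the dual pair)
  have hinj : ∀ b b' : T, Nonempty (M b ≅ M b') → b = b' := by
    rintro b b' ⟨i⟩
    have h := D.eq_of_nonempty_iso t (D.sliceBundle b'.1.left t (Over.w b'.1)) (D.sliceBundle_fibrewisePicZero _ t _)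
      b.1.left b'.1.left (Over.w b.1) (Over.w b'.1) ⟨i⟩ ⟨Iso.refl _⟩
    exact Subtype.ext (Over.OverMorphism.ext h)
  -- the kernel translations fix the global functions of `X_t` (Stein: they come from `Spec ℂ`, through `A_t`)
  have hfix : ∀ (g : AbelianVariety.Hom.kerPoints (specOver ℂ ℂ) f)
      (b : Γ((X.fibre t).toAbelianVariety.X.left, AbelianVariety.Hom.toSchemeHom f ⁻¹ᵁ ⊤)),
      ((AbelianVariety.kerTranslationActionOver f).aut g).hom.appLE (AbelianVariety.Hom.toSchemeHom f ⁻¹ᵁ ⊤)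
        (AbelianVariety.Hom.toSchemeHom f ⁻¹ᵁ ⊤) ((AbelianVariety.kerTranslationActionOver f).preimage_preimage g ⊤).ge b = b := by
    intro g b
    obtain ⟨c, hc⟩ := ((X.baseChange t).appTop_bijective_of_isReduced).2 b
    have hb : b = (AbelianVariety.Hom.toSchemeHom f).app ⊤ ((A.fibre t).toAbelianVariety.X.hom.appTop c) := by
      rw [← hc]
      change ((X.fibre t).toAbelianVariety.X.hom).appTop c = _
      rw [← Over.w f.hom.hom.hom, Scheme.Hom.comp_appTop]
      rfl
    rw [hb]
    exact (AbelianVariety.kerTranslationActionOver f).appLE_aut_app g ⊤ _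
  -- `Γ(X_t, 𝒪)` is a domain (`X_t` is integral)
  haveI : IsIntegral (X.fibre t).toAbelianVariety.X.left :=
    GeometricallyIntegral.isIntegral_of_subsingleton (X.fibre t).toAbelianVariety.X.hom
  haveI : IsDomain Γ((X.fibre t).toAbelianVariety.X.left, AbelianVariety.Hom.toSchemeHom f ⁻¹ᵁ ⊤) :=
    inferInstanceAs (IsDomain Γ((X.fibre t).toAbelianVariety.X.left, ⊤))
  -- count
  obtain ⟨hfin, hcard⟩ := (AbelianVariety.kerTranslationActionOver f).finite_and_natCard_le_card_of_forall_iso hq hfree hfix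
    M e hinj
  refine ⟨Set.finite_coe_iff.mp hfin, ?_⟩
  change Nat.card T ≤ _
  exact hcard.trans_eq (Nat.card_eq_fintype_card (α := AbelianVariety.Hom.kerPoints (specOver ℂ ℂ) f)).symm

end DualPair

end AbelianSchemeOver

end Literature.AlgebraicGeometry.AbelianSchemes
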